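import Mathlib
import HarnessLib
import Literature.MathematicalPhysics.KineticTheory.HardSphereEulerProofs
import Summits.AtomisticToContinuum.HydrodynamicLimit.Theses.OneFlightGossipEngine

/-!
# Family bounds and one joint modulus — stub `stub_familyModulus` of line `Sketch`,
# crux `KineticCurrentsLDAlongFamilies` (stmt-AtomisticToContinuum-16659)

Route `OneFlightGossipEngine`, sub-problem `HydrodynamicLimit`. Stub S6 of the skeleton
`Cruxes/KineticCurrentsLDAlongFamilies/Lines/Sketch.lean`: along a jointly continuous positive
profile family `s ↦ (a s, θ₀ s, u₀ s)` on `[0, t₁] × 𝕋³` and a jointly continuous weight family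
`s ↦ (A s, b s, G s)`, the class functional
`F_s(x, v) = A_s(x) : w ⊗ w + (b_s(x) · w) G_s(x, |w|²)`, `w = v − u_s(x)`, is jointly continuous in
`(s, x, v)`. Hence, by compactness of `[0, t₁] × 𝕋³` (`𝕋³ = UnitAddTorus (Fin 3)` is a compact
space) and of `[0, t₁] × 𝕋³ × B̄(0, R)`:

* numeric bounds `Θ, U, Λ` of the profiles on `[0, t₁]` (`Θ⁻¹ ≤ θ₀ ≤ Θ`, `‖u₀‖ ≤ U`,
  `Λ⁻¹ ≤ a ≤ Λ`; a positive continuous function and its inverse are both bounded on a compact set);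
* for every velocity radius `R` and every `ω > 0` a `δ > 0` with `|F_s(x, v) − F_{s'}(x, v)| ≤ ω`
  whenever `s, s' ∈ [0, t₁]`, `|s − s'| ≤ δ`, `‖v‖ ≤ R` (Heine–Cantor on the compact set, read in
  the sup-metric of the product `ℝ × (𝕋³ × ℝ³)` along the fibre `(x, v)` fixed).

For `t₁ < 0` everything is vacuous (`Θ = Λ = 1`, `U = 0` work). Pure topology; Mathlib only.
-/

noncomputable section

open MeasureTheory Set Filter
open scoped ENNReal Topology

namespace Summit.AtomisticToContinuum.HydrodynamicLimit.Theorems.KineticCurrentsLDAlongFamiliesSketch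

open Literature.Analysis.FluidPDE (HardSphereFlow Config localMaxwellian canonicalDensity liouville)
open Literature.MathematicalPhysics.KineticTheory (T3 V3 hsDiameter localGibbsLaw localGibbsMeasure
  localGibbsProfile)
open Literature.Analysis.FluidPDE Literature.MathematicalPhysics.KineticTheory

/-- A jointly continuous positive family `f` on `[0, t₁] × 𝕋³` is pinched between `M⁻¹` and `M`
for some `M ≥ 1`: both `f` and `f⁻¹` are continuous, hence bounded on the compact set
`Icc 0 t₁ ×ˢ univ`. [folklore] -/
theorem exists_two_sided_bound_of_continuous_pos (t₁ : ℝ) (f : ℝ → T3 → ℝ)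
    (hf : Continuous (Function.uncurry f)) (hpos : ∀ s x, 0 < f s x) :
    ∃ M : ℝ, 1 ≤ M ∧ ∀ s ∈ Icc 0 t₁, ∀ x, M⁻¹ ≤ f s x ∧ f s x ≤ M := by
  have hK : IsCompact (Icc (0 : ℝ) t₁ ×ˢ (univ : Set T3)) := isCompact_Icc.prod isCompact_univ
  obtain ⟨C, hC⟩ := hK.exists_bound_of_continuousOn hf.continuousOn
  have hinv : Continuous fun p : ℝ × T3 => (Function.uncurry f p)⁻¹ :=
    hf.inv₀ fun p => (hpos p.1 p.2).ne'
  obtain ⟨C', hC'⟩ := hK.exists_bound_of_continuousOn hinv.continuousOn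
  refine ⟨max 1 (max C C'), le_max_left _ _, fun s hs x => ?_⟩
  have hmem : (s, x) ∈ Icc (0 : ℝ) t₁ ×ˢ (univ : Set T3) := Set.mk_mem_prod hs (mem_univ _)
  have h1 : f s x ≤ C := (Real.le_norm_self _).trans (hC (s, x) hmem)
  have h2 : (f s x)⁻¹ ≤ C' := (Real.le_norm_self _).trans (hC' (s, x) hmem)
  have hM : 0 < max 1 (max C C') := lt_of_lt_of_le one_pos (le_max_left _ _)
  refine ⟨?_, h1.trans ((le_max_left _ _).trans (le_max_right _ _))⟩
  rw [inv_le_comm₀ hM (hpos s x)]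
  exact h2.trans ((le_max_right _ _).trans (le_max_right _ _))

/-- A jointly continuous vector field family `u₀` on `[0, t₁] × 𝕋³` is bounded in norm by some
`U ≥ 0` (compactness of `Icc 0 t₁ ×ˢ univ`). [folklore] -/
theorem exists_norm_bound_of_continuous (t₁ : ℝ) (u₀ : ℝ → T3 → V3)
    (hu : Continuous (Function.uncurry u₀)) :
    ∃ U : ℝ, 0 ≤ U ∧ ∀ s ∈ Icc 0 t₁, ∀ x, ‖u₀ s x‖ ≤ U := by
  have hK : IsCompact (Icc (0 : ℝ) t₁ ×ˢ (univ : Set T3)) := isCompact_Icc.prod isCompact_univ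
  obtain ⟨C, hC⟩ := hK.exists_bound_of_continuousOn hu.continuousOn
  exact ⟨max 0 C, le_max_left _ _, fun s hs x =>
    (hC (s, x) (Set.mk_mem_prod hs (mem_univ _))).trans (le_max_right _ _)⟩

/-- Transverse modulus in the parameter: a continuous `Φ : ℝ × (𝕋³ × ℝ³) → ℝ` is uniformly
continuous on the compact set `[0, t₁] × 𝕋³ × B̄(0, R)` (Heine–Cantor), so for every `ω > 0`
there is `δ > 0` with `|Φ (s, x, v) − Φ (s', x, v)| ≤ ω` whenever `s, s' ∈ [0, t₁]`,
`|s − s'| ≤ δ` and `‖v‖ ≤ R` (the sup-distance of the two points is `|s − s'|`). [folklore] -/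
theorem exists_fibre_modulus (t₁ : ℝ) {Φ : ℝ × (T3 × V3) → ℝ} (hΦ : Continuous Φ) (R ω : ℝ)
    (hω : 0 < ω) :
    ∃ δ : ℝ, 0 < δ ∧ ∀ s ∈ Icc 0 t₁, ∀ s' ∈ Icc 0 t₁, |s - s'| ≤ δ →
      ∀ (x : T3) (v : V3), ‖v‖ ≤ R → |Φ (s, x, v) - Φ (s', x, v)| ≤ ω := by
  have hK : IsCompact (Icc (0 : ℝ) t₁ ×ˢ ((univ : Set T3) ×ˢ Metric.closedBall (0 : V3) R)) :=
    isCompact_Icc.prod (isCompact_univ.prod (isCompact_closedBall 0 R))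
  have hUC := hK.uniformContinuousOn_of_continuous hΦ.continuousOn
  rw [Metric.uniformContinuousOn_iff_le] at hUC
  obtain ⟨δ, hδ, h⟩ := hUC ω hω
  refine ⟨δ, hδ, fun s hs s' hs' hss' x v hv => ?_⟩
  have hm : ∀ r ∈ Icc (0 : ℝ) t₁,
      (r, x, v) ∈ Icc (0 : ℝ) t₁ ×ˢ ((univ : Set T3) ×ˢ Metric.closedBall (0 : V3) R) :=
    fun r hr => Set.mk_mem_prod hr (Set.mk_mem_prod (mem_univ _) (mem_closedBall_zero_iff.2 hv))
  have hd : dist (s, x, v) (s', x, v) ≤ δ := by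
    rw [Prod.dist_eq, Prod.dist_eq, dist_self, dist_self, max_self, max_eq_left dist_nonneg,
      Real.dist_eq]
    exact hss'
  have hclose := h _ (hm s hs) _ (hm s' hs') hd
  rwa [Real.dist_eq] at hclose

/-- Joint continuity of the class functional `(s, x, v) ↦ F_s(x, v) =
A_s(x) : w ⊗ w + (b_s(x) · w) G_s(x, |w|²)`, `w = v − u_s(x)`, along jointly continuous families
`u₀`, `A`, `b`, `G`: every piece is a finite sum / product / composition of continuous maps
(coordinates of `ℝ³ = EuclideanSpace ℝ (Fin 3)` are continuous). [folklore] -/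
theorem continuous_classFunctional_family (u₀ : ℝ → T3 → V3)
    (hu : Continuous (Function.uncurry u₀)) (A : ℝ → T3 → Fin 3 → Fin 3 → ℝ) (b : ℝ → T3 → V3)
    (G : ℝ → T3 × ℝ → ℝ) (hA : Continuous (Function.uncurry A))
    (hb : Continuous (Function.uncurry b)) (hG : Continuous (Function.uncurry G))
    (F : ℝ → T3 × V3 → ℝ) (hF : ∀ s y, F s y =
      (∑ j : Fin 3, ∑ k : Fin 3, A s y.1 j k * ((y.2 - u₀ s y.1) j * (y.2 - u₀ s y.1) k)) +
        (∑ j : Fin 3, b s y.1 j * (y.2 - u₀ s y.1) j) * G s (y.1, ‖y.2 - u₀ s y.1‖ ^ 2)) :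
    Continuous fun p : ℝ × (T3 × V3) => F p.1 p.2 := by
  have hrw : (fun p : ℝ × (T3 × V3) => F p.1 p.2) = fun p =>
      (∑ j : Fin 3, ∑ k : Fin 3,
          A p.1 p.2.1 j k * ((p.2.2 - u₀ p.1 p.2.1) j * (p.2.2 - u₀ p.1 p.2.1) k)) +
        (∑ j : Fin 3, b p.1 p.2.1 j * (p.2.2 - u₀ p.1 p.2.1) j) *
          G p.1 (p.2.1, ‖p.2.2 - u₀ p.1 p.2.1‖ ^ 2) := by
    funext p
    exact hF p.1 p.2
  rw [hrw]
  have hsx : Continuous fun p : ℝ × (T3 × V3) => (p.1, p.2.1) :=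
    continuous_fst.prodMk (continuous_fst.comp continuous_snd)
  have hu' : Continuous fun p : ℝ × (T3 × V3) => u₀ p.1 p.2.1 := hu.comp hsx
  have hw : Continuous fun p : ℝ × (T3 × V3) => p.2.2 - u₀ p.1 p.2.1 :=
    (continuous_snd.comp continuous_snd).sub hu'
  have hwj : ∀ j : Fin 3, Continuous fun p : ℝ × (T3 × V3) => (p.2.2 - u₀ p.1 p.2.1) j :=
    fun j => (PiLp.continuous_apply 2 _ j).comp hw
  have hAjk : ∀ j k : Fin 3, Continuous fun p : ℝ × (T3 × V3) => A p.1 p.2.1 j k :=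
    fun j k => (continuous_apply k).comp ((continuous_apply j).comp (hA.comp hsx))
  have hbj : ∀ j : Fin 3, Continuous fun p : ℝ × (T3 × V3) => b p.1 p.2.1 j :=
    fun j => (PiLp.continuous_apply 2 _ j).comp (hb.comp hsx)
  have hG' : Continuous fun p : ℝ × (T3 × V3) => G p.1 (p.2.1, ‖p.2.2 - u₀ p.1 p.2.1‖ ^ 2) :=
    hG.comp (continuous_fst.prodMk ((continuous_fst.comp continuous_snd).prodMk (hw.norm.pow 2)))
  exact (continuous_finsetSum _ fun j _ => continuous_finsetSum _ fun k _ =>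
      (hAjk j k).mul ((hwj j).mul (hwj k))).add
    ((continuous_finsetSum _ fun j _ => (hbj j).mul (hwj j)).mul hG')

/-- **S6 — bounds and one joint modulus of the family** (stub `stub_familyModulus` of line
`Sketch`, crux `KineticCurrentsLDAlongFamilies`, stmt-AtomisticToContinuum-16659). Along a
jointly continuous positive profile family and a jointly continuous weight family, the class
functional `F_s(x,v) = A_s(x):w⊗w + (b_s(x)·w)G_s(x,|w|²)`, `w = v − u_s(x)`, is jointly
continuous in `(s,x,v)`; hence: numeric bounds `Θ, U, Λ` of the profiles on `[0,t₁]`, and for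
every velocity radius `R` and `ω > 0` a `δ > 0` with `|F_s(x,v) − F_{s'}(x,v)| ≤ ω` whenever
`s, s' ∈ [0,t₁]`, `|s − s'| ≤ δ`, `‖v‖ ≤ R` (compactness of `[0,t₁] × 𝕋³` and of
`[0,t₁] × 𝕋³ × B̄(0,R)`, Heine–Cantor). [folklore] -/
theorem stub_familyModulus :
    ∀ (t₁ : ℝ) (a θ₀ : ℝ → T3 → ℝ) (u₀ : ℝ → T3 → V3),
    Continuous (Function.uncurry a) → Continuous (Function.uncurry θ₀) →
    Continuous (Function.uncurry u₀) → (∀ s x, 0 < a s x) → (∀ s x, 0 < θ₀ s x) →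
    ∀ (A : ℝ → T3 → Fin 3 → Fin 3 → ℝ) (b : ℝ → T3 → V3) (G : ℝ → T3 × ℝ → ℝ),
    Continuous (Function.uncurry A) → Continuous (Function.uncurry b) →
    Continuous (Function.uncurry G) →
    ∀ F : ℝ → T3 × V3 → ℝ, (∀ s y, F s y =
      (∑ j : Fin 3, ∑ k : Fin 3, A s y.1 j k * ((y.2 - u₀ s y.1) j * (y.2 - u₀ s y.1) k)) +
        (∑ j : Fin 3, b s y.1 j * (y.2 - u₀ s y.1) j) * G s (y.1, ‖y.2 - u₀ s y.1‖ ^ 2)) →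
    ∃ Θ U Λ : ℝ, 1 ≤ Θ ∧ 0 ≤ U ∧ 1 ≤ Λ ∧
      (∀ s ∈ Icc 0 t₁, ∀ x, Θ⁻¹ ≤ θ₀ s x ∧ θ₀ s x ≤ Θ) ∧
      (∀ s ∈ Icc 0 t₁, ∀ x, ‖u₀ s x‖ ≤ U) ∧
      (∀ s ∈ Icc 0 t₁, ∀ x, Λ⁻¹ ≤ a s x ∧ a s x ≤ Λ) ∧
      ∀ R : ℝ, ∀ ω : ℝ, 0 < ω → ∃ δ : ℝ, 0 < δ ∧
        ∀ s ∈ Icc 0 t₁, ∀ s' ∈ Icc 0 t₁, |s - s'| ≤ δ →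
        ∀ (x : T3) (v : V3), ‖v‖ ≤ R → |F s (x, v) - F s' (x, v)| ≤ ω := by
  intro t₁ a θ₀ u₀ ha hθ hu ha0 hθ0 A b G hA hb hG F hF
  obtain ⟨Θ, hΘ1, hΘ⟩ := exists_two_sided_bound_of_continuous_pos t₁ θ₀ hθ hθ0
  obtain ⟨Λ, hΛ1, hΛ⟩ := exists_two_sided_bound_of_continuous_pos t₁ a ha ha0
  obtain ⟨U, hU0, hU⟩ := exists_norm_bound_of_continuous t₁ u₀ hu
  refine ⟨Θ, U, Λ, hΘ1, hU0, hΛ1, hΘ, hU, hΛ, fun R ω hω => ?_⟩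
  have hcont : Continuous fun p : ℝ × (T3 × V3) => F p.1 p.2 :=
    continuous_classFunctional_family u₀ hu A b G hA hb hG F hF
  obtain ⟨δ, hδ, h⟩ := exists_fibre_modulus t₁ hcont R ω hω
  exact ⟨δ, hδ, h⟩

end Summit.AtomisticToContinuum.HydrodynamicLimit.Theorems.KineticCurrentsLDAlongFamiliesSketch

end
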